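import Summits.BirchSwinnertonDyer.Rank1Residual.GaloisImage.KuriharaRecordBSDpThreeLevelOneEndOfFacts
import Summits.BirchSwinnertonDyer.Rank1Residual.GaloisImage.PropagatedConditionCardEP
import HarnessLib

/-!
# R1-57-B, part 5: the END-m1 record ENDs of the p18 lineage with Tate's local Euler–Poincaré
# characteristic DISCHARGED (`hEP` ↦ n1011-p04's `EP.forall_localEulerPoincareCharacteristic_adicCompletion ℚ`,
# over `EPCTate.localEulerPoincareCharacteristic`, p300886 / p301684)
# (cell `b2b-bsdres`, team n1011, ROUTE-1 §33.3 R1-57; OWNERS row T-R1-57-B lineage; seat p18; lead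
# R5-75 (b)(i) / ADD 3 / R5-76 (b): "one `_noEP`/EPC corollary per END theorem, owner lineage only, one
# `<File>EPC|NoEP.lean` sibling, binder diff = {hEP}; prefer the one-token `EP.…_adicCompletion`")

HONEST FRAMING (cell `b2b-bsdres`, run/shared/lean/b2b/bsd-rank1-residual/, verbatim in every
file): the goal of the cell is to DELETE the COMBINATION-SHAPED residual classes of the
Birch–Swinnerton-Dyer formula for ALL analytic-rank `≤ 1` elliptic curves over `ℚ` — "full BSD
formula for every rank `≤ 1` curve in class `C`" assembled STRICTLY from published theorems — so
that the rank-`≤ 1` remainder becomes exactly the CONSTRUCTION-SHAPED classes, which are TYPED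
(missing-input `Prop`s), NOT attempted. This is not "finishing BSD". Team n1011 (N10/N11, the
additive block `X4 ∧ p = 3`): research route; PER-PAIR record shape, NOT a class theorem; TOOL
theorems only (no definition, no named fact); nothing booked; no mark / label moved; the shapes
CLOSE NOTHING.  END-m1 is DEBT REDUCTION (`BSD(E,3)` only where `ord₃(L(E,1)/Ω_E) ≤ 2`), not
coverage: CONDITIONAL on the UPPER-half facts of the X4 chain of record, Cassels–Tate, the Poitou–Tate
family at `3` (or the named fact `hPT`), and the ONE port `KatoKuriharaPortThreeAt W 0 v₃` (FLAG
`K22-Thm3.13-PORT@3`, construction-shaped, NOT in print at `3`); NO [S24] fact; and — in this file — NO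
`hEP` binder: Tate's local Euler–Poincaré characteristic formula is n1011-p04's THEOREM (T-EPC,
p300886), a hypothesis DISCHARGED BY A THEOREM.  The Kurihara values stay EVIDENCE hypotheses.

## What and why (lead R5-75 (b)(i), ADD 3, R5-76 (b))

The [S24]-free END-m1 ENDs of this lineage — `KuriharaRecordBSDpThreeLevelOneEndOfBaseRigidity`
(p292786: `Sel₃ ≠ 0` + the two record corollaries over the Poitou–Tate family) and
`KuriharaRecordBSDpThreeLevelOneEndOfFacts` (p294284: the two NAMED-FACTS corollaries) — carry
`hEP : ∀ v, localEulerPoincareCharacteristic (v.adicCompletion ℚ)`, consumed by the 36 END-m1 records of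
the p03 lineage and the pilot `Additive/X4ThreeKuriharaEndM1Record2718d1`.  This sibling feeds `hEP`
by the cell's one-token discharge `EP.forall_localEulerPoincareCharacteristic_adicCompletion ℚ`
(n1011-p04, p301684, over `EPCTate.localEulerPoincareCharacteristic` p300886), one corollary per END,
binder diff = {`hEP`}:

* `exists_ne_zero_mem_selmerGroup_three_of_port_of_kolyvaginProduct_of_baseRigidity_noEP`,
* `bsdp_three_{of_towerSurj,potMult}_of_levelOneCertificates_of_baseRigidity_noEP`,
* `bsdp_three_{of_towerSurj,potMult}_of_levelOneCertificates_of_facts_noEP`.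

(n1011-p03's `…LevelOneEndNoRank` / `…LargeLevel` ENDs get their EPC siblings from the p03 lineage;
the END-m2 ENDs have theirs in `KuriharaRecordBSDpThreeLevelTwoEndNoEP`, p301722.)

References: J. S. Milne, *Arithmetic Duality Theorems* (2006) I Thm. 2.8, Thm. 4.10 [MilneADT2006];
C.-H. Kim, AJM 148 (2026) Thm. 1.9 (6), Thm. 3.13 [Kim2022StructureSelmer]; K. Rubin, PCMI 18 (2011)
Thm. 2.8.4 [Rubin2011]; K. Kato, Astérisque 295 (2004) Thm. 14.5 (3) [Kato2004Asterisque]; D. Delbourgo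
(1998) Prop. 4 [Delbourgo1998]; A. Agashe, K. Ribet, W. Stein (2006) Thm. 2.6 [AgasheRibetStein2006].
-/

noncomputable section

open scoped Classical NumberField ContRepresentation
open Function Field NumberField IsDedekindDomain IsDedekindDomain.HeightOneSpectrum WeierstrassCurve
  CongruenceSubgroup
  Literature.NumberTheory.EllipticCurves Literature.NumberTheory.EllipticCurves.ModularForms
  Literature.NumberTheory.EllipticCurves.Rank1Residual
  Literature.NumberTheory.EllipticCurves.AgasheRibetStein2006
  Literature.NumberTheory.GaloisRepresentations
  Literature.NumberTheory.GaloisRepresentations.DiscreteGaloisModule Literature.NumberTheory.GaloisCohomology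
  Rat.HeightOneSpectrum
  Summit.BirchSwinnertonDyer.Rank1Residual.Additive Summit.BirchSwinnertonDyer.Rank1Residual.X4

namespace Summit.BirchSwinnertonDyer.Rank1Residual.GaloisImage.Assembly

/-- **`Sel₃(E) ≠ 0` from ONE level-one Kurihara unit, in RECORD currency — [S24]-FREE and `hEP`-FREE.**
Exactly `exists_ne_zero_mem_selmerGroup_three_of_port_of_kolyvaginProduct_of_baseRigidity` (p292786)
with the binder `hEP` DISCHARGED by n1011-p04's `EP.forall_localEulerPoincareCharacteristic_adicCompletion ℚ`
(hEP discharged by p300886); every other binder unchanged and in the same order.  CLOSES NOTHING.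
[cite: Kim2022StructureSelmer, Thm. 3.13] [cite: Rubin2011, Thm. 2.8.4] [cite: MilneADT2006, Ch. I §2, Thm. 2.8 (p. 31)] -/
theorem exists_ne_zero_mem_selmerGroup_three_of_port_of_kolyvaginProduct_of_baseRigidity_noEP
    (W : WeierstrassCurve ℚ) [W.IsElliptic] [W.IsGloballyMinimal]
    (hadd : haveI : Fact (Nat.Prime 3) := ⟨Nat.prime_three⟩; Addv W 3)
    (hc3 : ¬ 3 ∣ (W.baseChange ℚ_[3]).localTamagawaNumber ℤ_[3])
    (hsurj : W.HasSurjectiveModNGaloisRep ((3 : ℕ) : ℤ))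
    (ht0 : Nat.card {Q : (W.baseChange ℚ_[3]).toAffine.Point // (3 : ℕ) • Q = 0} = 1)
    {N : ℕ} [NeZero N] (D : ModularParametrizationData W N)
    (hcP : ¬ ((3 : ℕ) : ℤ) ∣ D.maninConstant)
    (hper : ∃ u : ℚ, ‖(u : ℚ_[3])‖ = 1 ∧ W.realPeriodRat = u * plusPeriod D.f)
    (inv : LocalInvariants ℚ 3) (hperf : inv.IsPerfect) (hsum : inv.SumLocalTermEqZero)
    (hcompl : inv.SelmerComplement)
    (v₃ : HeightOneSpectrum (𝓞 ℚ)) (hv₃ : ((3 : ℕ) : 𝓞 ℚ) ∈ v₃.asIdeal)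
    (hPort : KatoKuriharaPortThreeAt W 0 v₃)
    (n : ℕ) [NeZero n] (hn : Kato.IsKolyvaginProduct W 3 1 n)
    (hcyc : ∀ (ℓ : ℕ) [Fact ℓ.Prime], ℓ ∣ n →
      Nat.card {P : ((integralModelInt W).map (Int.castRingHom (ZMod ℓ))).toAffine.Point //
        3 • P = 0} ≤ 3)
    (ψ : (ℓ : ℕ) → (ZMod ℓ)ˣ →* Multiplicative (ZMod (3 ^ 1)))
    (hψ : ∀ ℓ ∈ n.primeFactors, Function.Surjective (ψ ℓ))
    (hcert : kuriharaNumber D.f (3 ^ 1) n ψ ≠ 0)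
    (hzero₁ : kuriharaNumber D.f (3 ^ 1) 1 ψ = 0) :
    ∃ x ∈ (W.kummerSelmerStructure ((3 : ℕ) : ℤ)).selmerGroup, x ≠ 0 :=
  exists_ne_zero_mem_selmerGroup_three_of_port_of_kolyvaginProduct_of_baseRigidity W hadd hc3 hsurj ht0 D
    hcP hper inv hperf hsum hcompl
    (EP.forall_localEulerPoincareCharacteristic_adicCompletion ℚ) v₃ hv₃ hPort n hn hcyc ψ hψ hcert hzero₁

/-- **END-m1 RECORD COROLLARY, [S24]-FREE, `hEP`-FREE (potentially GOOD rows / tower form).**  Exactly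
`bsdp_three_of_towerSurj_of_levelOneCertificates_of_baseRigidity` (p292786) with `hEP` DISCHARGED by
`EP.forall_localEulerPoincareCharacteristic_adicCompletion ℚ` (hEP discharged by p300886); binder diff = {hEP}.
CLOSES NOTHING; values = EVIDENCE.
[cite: Kim2022StructureSelmer, Thm. 1.9 (6) and Thm. 3.13] [cite: Rubin2011, Thm. 2.8.4]
[cite: Kato2004Asterisque, Thm. 14.5 (3) (p. 236)] [cite: MilneADT2006, Ch. I §2, Thm. 2.8 (p. 31)] -/
theorem bsdp_three_of_towerSurj_of_levelOneCertificates_of_baseRigidity_noEP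
    (hKatoS : Kato2004.rankZero_padicValNat_sha_le_sub_localTamagawa_of_additive_potGood_of_imageContainsSL2)
    (hDel : Delbourgo1998.prop4_rankZero_pow_dvd_constantCoeff)
    (hGZK : rank_eq_analyticRank_of_analyticRank_le_one) (hmod : hasEntireLFunction_rat)
    (hmodD : nonempty_modularParametrizationData)
    (hKatoχ : Wuthrich2014.kato_halfEigenCharIdeal_dvd_cyclotomicPrime_of_surjective)
    (h26 : cremona_abs_maninConstant_eq_one_of_level_le)
    (hCT : exists_casselsTate_pairing (K := ℚ))
    (W : WeierstrassCurve ℚ) [W.IsElliptic] [W.IsGloballyMinimal]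
    -- the row
    {E₀ : WeierstrassCurve ℤ} (hI : integralModelInt W = E₀)
    (hΔ : (3 : ℤ) ∣ E₀.Δ) (hc₄ : (3 : ℤ) ∣ E₀.c₄)
    (htower : ∀ m : ℕ, W.HasSurjectiveModNGaloisRep (3 ^ m : ℕ))
    (ht0 : Nat.card {Q : (W.baseChange ℚ_[3]).toAffine.Point // (3 : ℕ) • Q = 0} = 1)
    (hr : W.analyticRank = 0) (htam : ¬ 3 ∣ W.tamagawaProduct)
    {N : ℕ} [NeZero N] (hN : N ≤ 130000) (D : ModularParametrizationData W N)
    (hopt : ∀ z ∈ D.L.lattice, ∃ w ∈ periodLattice D.f, z = D.c * w)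
    -- the Poitou–Tate family at `3`, Tate's local Euler characteristic, ONE port
    (inv : LocalInvariants ℚ 3) (hperf : inv.IsPerfect) (hsum : inv.SumLocalTermEqZero)
    (hcompl : inv.SelmerComplement)
    (v₃ : HeightOneSpectrum (𝓞 ℚ)) (hv₃ : ((3 : ℕ) : 𝓞 ℚ) ∈ v₃.asIdeal)
    (hPort : KatoKuriharaPortThreeAt W 0 v₃)
    -- the certificate: ONE level-one unit, two level-zero fields
    (n : ℕ) [NeZero n] (hn : Kato.IsKolyvaginProduct W 3 1 n)
    (hcyc : ∀ (ℓ : ℕ) [Fact ℓ.Prime], ℓ ∣ n →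
      Nat.card {P : ((integralModelInt W).map (Int.castRingHom (ZMod ℓ))).toAffine.Point //
        3 • P = 0} ≤ 3)
    (ψ : (ℓ : ℕ) → (ZMod ℓ)ˣ →* Multiplicative (ZMod (3 ^ 1)))
    (hψ : ∀ ℓ ∈ n.primeFactors, Function.Surjective (ψ ℓ))
    (hcert : kuriharaNumber D.f (3 ^ 1) n ψ ≠ 0)
    (hzero₁ : kuriharaNumber D.f (3 ^ 1) 1 ψ = 0)
    (ψ₂₇ : (ℓ : ℕ) → (ZMod ℓ)ˣ →* Multiplicative (ZMod (3 ^ 3)))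
    (hunit₁ : kuriharaNumber D.f (3 ^ 3) 1 ψ₂₇ ≠ 0) :
    BSDp W 3 :=
  bsdp_three_of_towerSurj_of_levelOneCertificates_of_baseRigidity hKatoS hDel hGZK hmod hmodD hKatoχ h26
    hCT W hI hΔ hc₄ htower ht0 hr htam hN D hopt inv hperf hsum hcompl
    (EP.forall_localEulerPoincareCharacteristic_adicCompletion ℚ) v₃ hv₃ hPort n hn hcyc ψ hψ hcert hzero₁ ψ₂₇ hunit₁

/-- **END-m1 RECORD COROLLARY, [S24]-FREE, `hEP`-FREE (potentially MULTIPLICATIVE rows).**  Exactly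
`bsdp_three_potMult_of_levelOneCertificates_of_baseRigidity` (p292786) with `hEP` DISCHARGED by
`EP.forall_localEulerPoincareCharacteristic_adicCompletion ℚ` (hEP discharged by p300886); binder diff = {hEP}.
CLOSES NOTHING; values = EVIDENCE.
[cite: Kim2022StructureSelmer, Thm. 1.9 (6) and Thm. 3.13] [cite: Rubin2011, Thm. 2.8.4]
[cite: Delbourgo1998, Prop. 4 (p. 144)] [cite: MilneADT2006, Ch. I §2, Thm. 2.8 (p. 31)] -/
theorem bsdp_three_potMult_of_levelOneCertificates_of_baseRigidity_noEP
    (hKatoS : Kato2004.rankZero_padicValNat_sha_le_sub_localTamagawa_of_additive_potGood_of_imageContainsSL2)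
    (hDel : Delbourgo1998.prop4_rankZero_pow_dvd_constantCoeff)
    (hGZK : rank_eq_analyticRank_of_analyticRank_le_one) (hmod : hasEntireLFunction_rat)
    (hmodD : nonempty_modularParametrizationData)
    (hKatoχ : Wuthrich2014.kato_halfEigenCharIdeal_dvd_cyclotomicPrime_of_surjective)
    (h26 : cremona_abs_maninConstant_eq_one_of_level_le)
    (hCT : exists_casselsTate_pairing (K := ℚ))
    (W : WeierstrassCurve ℚ) [W.IsElliptic] [W.IsGloballyMinimal]
    {E₀ : WeierstrassCurve ℤ} (hI : integralModelInt W = E₀)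
    (hΔ : (3 : ℤ) ∣ E₀.Δ) (hc₄ : (3 : ℤ) ∣ E₀.c₄)
    (hsurj : W.HasSurjectiveModNGaloisRep ((3 : ℕ) : ℤ)) (hjneg : padicValRat 3 W.j < 0)
    (hc3 : ¬ 3 ∣ (W.baseChange ℚ_[3]).localTamagawaNumber ℤ_[3])
    (ht0 : Nat.card {Q : (W.baseChange ℚ_[3]).toAffine.Point // (3 : ℕ) • Q = 0} = 1)
    (hr : W.analyticRank = 0)
    {N : ℕ} [NeZero N] (hN : N ≤ 130000) (D : ModularParametrizationData W N)
    (hopt : ∀ z ∈ D.L.lattice, ∃ w ∈ periodLattice D.f, z = D.c * w)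
    (inv : LocalInvariants ℚ 3) (hperf : inv.IsPerfect) (hsum : inv.SumLocalTermEqZero)
    (hcompl : inv.SelmerComplement)
    (v₃ : HeightOneSpectrum (𝓞 ℚ)) (hv₃ : ((3 : ℕ) : 𝓞 ℚ) ∈ v₃.asIdeal)
    (hPort : KatoKuriharaPortThreeAt W 0 v₃)
    (n : ℕ) [NeZero n] (hn : Kato.IsKolyvaginProduct W 3 1 n)
    (hcyc : ∀ (ℓ : ℕ) [Fact ℓ.Prime], ℓ ∣ n →
      Nat.card {P : ((integralModelInt W).map (Int.castRingHom (ZMod ℓ))).toAffine.Point //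
        3 • P = 0} ≤ 3)
    (ψ : (ℓ : ℕ) → (ZMod ℓ)ˣ →* Multiplicative (ZMod (3 ^ 1)))
    (hψ : ∀ ℓ ∈ n.primeFactors, Function.Surjective (ψ ℓ))
    (hcert : kuriharaNumber D.f (3 ^ 1) n ψ ≠ 0)
    (hzero₁ : kuriharaNumber D.f (3 ^ 1) 1 ψ = 0)
    (ψ₂₇ : (ℓ : ℕ) → (ZMod ℓ)ˣ →* Multiplicative (ZMod (3 ^ 3)))
    (hunit₁ : kuriharaNumber D.f (3 ^ 3) 1 ψ₂₇ ≠ 0) :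
    BSDp W 3 :=
  bsdp_three_potMult_of_levelOneCertificates_of_baseRigidity hKatoS hDel hGZK hmod hmodD hKatoχ h26 hCT
    W hI hΔ hc₄ hsurj hjneg hc3 ht0 hr hN D hopt inv hperf hsum hcompl
    (EP.forall_localEulerPoincareCharacteristic_adicCompletion ℚ) v₃ hv₃ hPort n hn hcyc ψ hψ hcert hzero₁ ψ₂₇ hunit₁

/-- **END-m1 RECORD COROLLARY, NAMED-FACTS form, `hEP`-FREE (potentially GOOD rows / tower form).**
Exactly `bsdp_three_of_towerSurj_of_levelOneCertificates_of_facts` (p294284) with `hEP` DISCHARGED by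
`EP.forall_localEulerPoincareCharacteristic_adicCompletion ℚ` (hEP discharged by p300886); the record reads
NAMED FACTS {hKatoS hDel hGZK hmod hmodD hKatoχ h26 hCT hPT} + PORT + ROW + datum + VALUES.
CLOSES NOTHING; values = EVIDENCE.
[cite: Kim2022StructureSelmer, Thm. 1.9 (6) and Thm. 3.13] [cite: MilneADT2006, Ch. I, Thm. 2.8 and Thm. 4.10]
[cite: Kato2004Asterisque, Thm. 14.5 (3) (p. 236)] [cite: AgasheRibetStein2006, Thm. 2.6 (p. 619)] -/
theorem bsdp_three_of_towerSurj_of_levelOneCertificates_of_facts_noEP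
    (hKatoS : Kato2004.rankZero_padicValNat_sha_le_sub_localTamagawa_of_additive_potGood_of_imageContainsSL2)
    (hDel : Delbourgo1998.prop4_rankZero_pow_dvd_constantCoeff)
    (hGZK : rank_eq_analyticRank_of_analyticRank_le_one) (hmod : hasEntireLFunction_rat)
    (hmodD : nonempty_modularParametrizationData)
    (hKatoχ : Wuthrich2014.kato_halfEigenCharIdeal_dvd_cyclotomicPrime_of_surjective)
    (h26 : cremona_abs_maninConstant_eq_one_of_level_le)
    (hCT : exists_casselsTate_pairing (K := ℚ))
    (W : WeierstrassCurve ℚ) [W.IsElliptic] [W.IsGloballyMinimal]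
    -- the row
    {E₀ : WeierstrassCurve ℤ} (hI : integralModelInt W = E₀)
    (hΔ : (3 : ℤ) ∣ E₀.Δ) (hc₄ : (3 : ℤ) ∣ E₀.c₄)
    (htower : ∀ m : ℕ, W.HasSurjectiveModNGaloisRep (3 ^ m : ℕ))
    (ht0 : Nat.card {Q : (W.baseChange ℚ_[3]).toAffine.Point // (3 : ℕ) • Q = 0} = 1)
    (hr : W.analyticRank = 0) (htam : ¬ 3 ∣ W.tamagawaProduct)
    {N : ℕ} [NeZero N] (hN : N ≤ 130000) (D : ModularParametrizationData W N)
    (hopt : ∀ z ∈ D.L.lattice, ∃ w ∈ periodLattice D.f, z = D.c * w)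
    -- the Poitou–Tate family at `3`, Tate's local Euler characteristic, ONE port
    (hPT : poitouTate_selmerStructure_duality ℚ)
    (v₃ : HeightOneSpectrum (𝓞 ℚ)) (hv₃ : ((3 : ℕ) : 𝓞 ℚ) ∈ v₃.asIdeal)
    (hPort : KatoKuriharaPortThreeAt W 0 v₃)
    -- the certificate: ONE level-one unit, two level-zero fields
    (n : ℕ) [NeZero n] (hn : Kato.IsKolyvaginProduct W 3 1 n)
    (hcyc : ∀ (ℓ : ℕ) [Fact ℓ.Prime], ℓ ∣ n →
      Nat.card {P : ((integralModelInt W).map (Int.castRingHom (ZMod ℓ))).toAffine.Point //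
        3 • P = 0} ≤ 3)
    (ψ : (ℓ : ℕ) → (ZMod ℓ)ˣ →* Multiplicative (ZMod (3 ^ 1)))
    (hψ : ∀ ℓ ∈ n.primeFactors, Function.Surjective (ψ ℓ))
    (hcert : kuriharaNumber D.f (3 ^ 1) n ψ ≠ 0)
    (hzero₁ : kuriharaNumber D.f (3 ^ 1) 1 ψ = 0)
    (ψ₂₇ : (ℓ : ℕ) → (ZMod ℓ)ˣ →* Multiplicative (ZMod (3 ^ 3)))
    (hunit₁ : kuriharaNumber D.f (3 ^ 3) 1 ψ₂₇ ≠ 0) :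
    BSDp W 3 :=
  bsdp_three_of_towerSurj_of_levelOneCertificates_of_facts hKatoS hDel hGZK hmod hmodD hKatoχ h26 hCT W hI
    hΔ hc₄ htower ht0 hr htam hN D hopt hPT (EP.forall_localEulerPoincareCharacteristic_adicCompletion ℚ) v₃ hv₃
    hPort n hn hcyc ψ hψ hcert hzero₁ ψ₂₇ hunit₁

/-- **END-m1 RECORD COROLLARY, NAMED-FACTS form, `hEP`-FREE (potentially MULTIPLICATIVE rows).**
Exactly `bsdp_three_potMult_of_levelOneCertificates_of_facts` (p294284) with `hEP` DISCHARGED by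
`EP.forall_localEulerPoincareCharacteristic_adicCompletion ℚ` (hEP discharged by p300886).
CLOSES NOTHING; values = EVIDENCE.
[cite: Kim2022StructureSelmer, Thm. 1.9 (6) and Thm. 3.13] [cite: MilneADT2006, Ch. I, Thm. 2.8 and Thm. 4.10]
[cite: Delbourgo1998, Prop. 4 (p. 144)] [cite: AgasheRibetStein2006, Thm. 2.6 (p. 619)] -/
theorem bsdp_three_potMult_of_levelOneCertificates_of_facts_noEP
    (hKatoS : Kato2004.rankZero_padicValNat_sha_le_sub_localTamagawa_of_additive_potGood_of_imageContainsSL2)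
    (hDel : Delbourgo1998.prop4_rankZero_pow_dvd_constantCoeff)
    (hGZK : rank_eq_analyticRank_of_analyticRank_le_one) (hmod : hasEntireLFunction_rat)
    (hmodD : nonempty_modularParametrizationData)
    (hKatoχ : Wuthrich2014.kato_halfEigenCharIdeal_dvd_cyclotomicPrime_of_surjective)
    (h26 : cremona_abs_maninConstant_eq_one_of_level_le)
    (hCT : exists_casselsTate_pairing (K := ℚ))
    (W : WeierstrassCurve ℚ) [W.IsElliptic] [W.IsGloballyMinimal]
    {E₀ : WeierstrassCurve ℤ} (hI : integralModelInt W = E₀)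
    (hΔ : (3 : ℤ) ∣ E₀.Δ) (hc₄ : (3 : ℤ) ∣ E₀.c₄)
    (hsurj : W.HasSurjectiveModNGaloisRep ((3 : ℕ) : ℤ)) (hjneg : padicValRat 3 W.j < 0)
    (hc3 : ¬ 3 ∣ (W.baseChange ℚ_[3]).localTamagawaNumber ℤ_[3])
    (ht0 : Nat.card {Q : (W.baseChange ℚ_[3]).toAffine.Point // (3 : ℕ) • Q = 0} = 1)
    (hr : W.analyticRank = 0)
    {N : ℕ} [NeZero N] (hN : N ≤ 130000) (D : ModularParametrizationData W N)
    (hopt : ∀ z ∈ D.L.lattice, ∃ w ∈ periodLattice D.f, z = D.c * w)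
    (hPT : poitouTate_selmerStructure_duality ℚ)
    (v₃ : HeightOneSpectrum (𝓞 ℚ)) (hv₃ : ((3 : ℕ) : 𝓞 ℚ) ∈ v₃.asIdeal)
    (hPort : KatoKuriharaPortThreeAt W 0 v₃)
    (n : ℕ) [NeZero n] (hn : Kato.IsKolyvaginProduct W 3 1 n)
    (hcyc : ∀ (ℓ : ℕ) [Fact ℓ.Prime], ℓ ∣ n →
      Nat.card {P : ((integralModelInt W).map (Int.castRingHom (ZMod ℓ))).toAffine.Point //
        3 • P = 0} ≤ 3)
    (ψ : (ℓ : ℕ) → (ZMod ℓ)ˣ →* Multiplicative (ZMod (3 ^ 1)))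
    (hψ : ∀ ℓ ∈ n.primeFactors, Function.Surjective (ψ ℓ))
    (hcert : kuriharaNumber D.f (3 ^ 1) n ψ ≠ 0)
    (hzero₁ : kuriharaNumber D.f (3 ^ 1) 1 ψ = 0)
    (ψ₂₇ : (ℓ : ℕ) → (ZMod ℓ)ˣ →* Multiplicative (ZMod (3 ^ 3)))
    (hunit₁ : kuriharaNumber D.f (3 ^ 3) 1 ψ₂₇ ≠ 0) :
    BSDp W 3 :=
  bsdp_three_potMult_of_levelOneCertificates_of_facts hKatoS hDel hGZK hmod hmodD hKatoχ h26 hCT W hI hΔ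
    hc₄ hsurj hjneg hc3 ht0 hr hN D hopt hPT (EP.forall_localEulerPoincareCharacteristic_adicCompletion ℚ) v₃ hv₃
    hPort n hn hcyc ψ hψ hcert hzero₁ ψ₂₇ hunit₁

end Summit.BirchSwinnertonDyer.Rank1Residual.GaloisImage.Assembly

end
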